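import Literature.AnabelianGeometry.EtaleTheta.ConstantMultipleRigidity
import HarnessLib

/-!
# [EtTh] Theorem 1.10 (constant multiple rigidity) — SUB-DAG statements of the printed proof
# (cell sub-DAG `plan/L2/SUBDAG-EtTh-Thm110.md`, rows T110.*; holder abc-iut-w5-d140)

S. Mochizuki, *The étale theta function and its Frobenioid-theoretic manifestations*, Publ. RIMS 45
(2009), §1, Theorem 1.10, PRIMS pp.255–256 (PDF pp.29–30, read on the holder's own render)
[cite: MochizukiEtTh2009, Thm 1.10 p.29].  Printed proof (p.256 l.1–9): «assertions (i), (iii) follow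
formally from assertion (ii) [cf. also the series representation of Proposition 1.4] … By applying
[Mzk14], Theorem 6.8, (iii), together with the fact that γ induces isomorphisms between the dual graphs
[cf. Theorem 1.6, (i); [Mzk2], Lemma 2.3] … it follows that γ maps [the decomposition group of points of
Ÿ_α lying over] τ to [the decomposition group of points of Ÿ_β lying over] τ^{±1}. Now assertion (ii)
follows immediately.»

Typed statement of record (abc-iut-L2-t1): `ConstantMultipleRigidity.lean` — `Thm110Hypothesis`,
`Thm110i`, `Thm110iUnique`, `Thm110ii` over `MuTwoSetting` / `StandardData` / `valuesAt` /
`IsStandardSetOfValues` / `IsOfStandardType`.  This file types the INTERMEDIATE STATEMENTS of the printed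
proof over that vocabulary (each a `def … : Prop`, nothing asserted) and PROVES the purely formal
compositions:
* r5 `Thm110DecompTransport` — «γ maps D_τ to D_{τ^{±1}}» (⇐ [SemiAnbd] Thm 6.8 (iii) + Thm 1.6 (i));
* r6 `Thm110ValuesForward` / `Thm110ValuesBackward` — the correspondence of STANDARD SETS OF VALUES under
  the isomorphism `δ : K̈_α^× ⥲ K̈_β^×` induced by γ on Kummer classes («(ii) follows immediately»: r5 +
  naturality of the evaluation at points — the §1 interface carries `NonCuspidalPoint.evalAt` as free
  data per point, so this inference is an intermediate statement, not a derivation);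
  PROVED: `thm110ii_of_valuesForward` (r6 ⇒ the typed `Thm110ii`);
* r7 `Thm110DeltaCompat` — δ preserves `O^×`, the order by absolute value («the unique value of maximal
  order») and `±1` (⇐ [AbsAnab] Prop 1.2.1 (ii)(iii)(v) through the `G_K`-isomorphism underlying γ);
  PROVED: `isOfStandardType_transfer`, `thm110i_of_values_of_deltaCompat` (r6 both ways + r7 ⇒ `Thm110i`);
* r8 `StandardValuesNormInjective`, `StandardValuesInvSymm` — the two uses of «the series representation
  of Proposition 1.4» behind (i)'s «determines … up to ±1» (distinct absolute values inside a standard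
  set; the values at τ⁻¹ versus those at τ); the translation law of values under `u ∈ O^×_{K̈}` is the
  interface-formal part (holder's proof file, to follow).
v2 (2026-08-26, shape agreed with the §1 owner abc-iut-L2-t1): `Thm110UnitClassEquivariance` (V2′: Π^tp_Ẋ-equivariance of
the unit Kummer classes) and `StandardValuesFormula` (V1′: the value formula at τ) — the two
interface-invisible inputs of (i)'s uniqueness clause; the thetaDdot-level order computation is
abc-iut-L2-t6's `ClassicalThetaValueOrders.lean`.
v3 (2026-08-26, finding F-L2t6g4-1 of abc-iut-L2-t6, accepted by the holder): V1′ is SIGN-BLIND — of the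
two admissible choices `ε_Z ∈ {[q̈], [−q̈]}` (Def 1.7, p.253: «for some choice of ε_Z») it holds at the
genuine model only on the `[q̈]`-branch; on the `[−q̈]`-branch the values at τ are
`{(−1)^a · q̈^(−a²) · v₀}`.  `StandardValuesFormulaSigned` (V1″) carries the branch sign `s = ±1`;
`standardValuesFormulaSigned_of_formula` records V1′ ⇒ V1″ (`s = 1`).  V1′ is kept unchanged (it is
the `[q̈]`-branch special case); consumers should use V1″.
(iii) is not typed upstream (torsors at cusps = [GalSect] §4, layer L4) — recorded in the table only.
HONEST FRAMING: OUR typing of the steps of a refereed proof; typed ≠ proved; nothing here bears on the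
disputed [IUTchIII] Cor. 3.12.
-/

noncomputable section

namespace Literature.AnabelianGeometry.EtaleTheta

open Literature.AnabelianGeometry.SemiGraphs

variable {p : ℕ} [Fact p.Prime]

section Thm110Sub

variable {Mα Mβ : MuTwoSetting p}
variable {εα : Mα.GtpC} {εβ : Mβ.GtpC} {hCα : Mα.toThetaSetting.Compat}
  {hCβ : Mβ.toThetaSetting.Compat} {Eα : Mα.toThetaSetting.EtaleThetaData}
  {Eβ : Mβ.toThetaSetting.EtaleThetaData} {γ : Mα.dotC εα ≃ₜ* Mβ.dotC εβ}

/-- **Row T110.ii.r5 — the intermediate statement of the printed proof of Thm 1.10 (ii)** (p.256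
l.6–8): «γ maps [the decomposition group of points of Ÿ_α lying over] τ to [the decomposition group of
points of Ÿ_β lying over] τ^{±1}» — typed: the isomorphism `Π^tp_{Xα} ⥲ Π^tp_{Xβ}` induced by γ carries
the decomposition group of the point `τ_α` of the standard data onto a `Π^tp_{Ẋβ}`-conjugate of the
decomposition group of `τ_β` OR of `τ_β⁻¹` (the sign ambiguity is the `ε_μ, ε_±` of Rmk 1.9.1).  Inputs
named by print: [SemiAnbd] = [Mzk14] Thm 6.8 (iii) (isomorphisms of tempered fundamental groups preserve
decomposition groups of closed points), Thm 1.6 (i) (`Thm110Hypothesis.thm16i`: dual graphs), [Mzk2]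
Lem 2.3.  Intermediate statement; not asserted. [cite: MochizukiEtTh2009, Thm 1.10 (ii) p.30] -/
def Thm110DecompTransport (H : Thm110Hypothesis εα εβ hCα hCβ Eα Eβ γ)
    (Sα : Mα.StandardData Eα.toKummerData) (Sβ : Mβ.StandardData Eβ.toKummerData) : Prop :=
  ∃ σ : Mβ.PiTemp, Mβ.inclX σ ∈ Mβ.dotX εβ ∧
    (Sα.tau.Dpt.map H.γX.toMulEquiv.toMonoidHom =
        Sβ.tau.Dpt.map (MulAut.conj σ).toMonoidHom ∨
      Sα.tau.Dpt.map H.γX.toMulEquiv.toMonoidHom =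
        Sβ.tauInv.Dpt.map (MulAut.conj σ).toMonoidHom)

/-- "The isomorphism `K^×_α ⥲ K^×_β` … induced by γ" (Thm 1.10 (ii), p.256 l.−6…−4: `K^× ⊆ (K^×)^∧ =
H¹(G_K, Δ_Θ) ⊆ H¹(Π^tp_Ċ, Δ_Θ)`): `δ` IS induced by γ when the transport along `(γX, companion)` of the
inflated Kummer class of every constant `a ∈ K̈_α^×` is the inflated Kummer class of `δ a` (the first
clause of the typed `Thm110ii`). [cite: MochizukiEtTh2009, Thm 1.10 (ii) p.30] -/
def Thm110DeltaInduced (H : Thm110Hypothesis εα εβ hCα hCβ Eα Eβ γ)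
    (δ : (↥Mα.Kdd)ˣ ≃* (↥Mβ.Kdd)ˣ) : Prop :=
  ∀ a : (↥Mα.Kdd)ˣ,
    ThetaSetting.transport H.companion H.thm16i
        (Mα.toThetaSetting.inflTheta Mα.toThetaSetting.GtpYdd (Eα.kumYdd (Eα.toKddHat a))) =
      Mβ.toThetaSetting.inflTheta Mβ.toThetaSetting.GtpYdd (Eβ.kumYdd (Eβ.toKddHat (δ a)))

/-- **Row T110.ii.r6 (forward half) — «Now assertion (ii) follows immediately»**: under the `δ`
induced by γ, every STANDARD SET OF VALUES of `η̈^{Θ,Z}_α` is carried to a standard set of values of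
`η̈^{Θ,Z}_β` (⇐ r5 and the NATURALITY OF EVALUATION `eval_{τ′β} ∘ res ∘ transport = δ ∘ eval_{τα} ∘ res`,
which has no carrier in the §1 interface — `NonCuspidalPoint.evalAt` is free data per point — and is
therefore part of this intermediate statement).  Intermediate statement; not asserted.
[cite: MochizukiEtTh2009, Thm 1.10 (ii) p.30] -/
def Thm110ValuesForward (H : Thm110Hypothesis εα εβ hCα hCβ Eα Eβ γ)
    (Sα : Mα.StandardData Eα.toKummerData) (Sβ : Mβ.StandardData Eβ.toKummerData)
    (δ : (↥Mα.Kdd)ˣ ≃* (↥Mβ.Kdd)ˣ) : Prop :=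
  Thm110DeltaInduced H δ ∧
    ∀ V, Mα.IsStandardSetOfValues hCα εα Sα Eα.etaDd V →
      Mβ.IsStandardSetOfValues hCβ εβ Sβ Eβ.etaDd (δ '' V)

/-- **Row T110.ii.r6 (backward half)**: the same for `γ⁻¹` / `δ⁻¹` — every standard set of values of
`η̈^{Θ,Z}_β` comes from one of `η̈^{Θ,Z}_α` (the printed (ii) is a statement about the ISOMORPHISM
`K^×_α ⥲ K^×_β`, used in both directions by (i)).  Intermediate statement; not asserted.
[cite: MochizukiEtTh2009, Thm 1.10 (ii) p.30] -/
def Thm110ValuesBackward (H : Thm110Hypothesis εα εβ hCα hCβ Eα Eβ γ)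
    (Sα : Mα.StandardData Eα.toKummerData) (Sβ : Mβ.StandardData Eβ.toKummerData)
    (δ : (↥Mα.Kdd)ˣ ≃* (↥Mβ.Kdd)ˣ) : Prop :=
  Thm110DeltaInduced H δ ∧
    ∀ W, Mβ.IsStandardSetOfValues hCβ εβ Sβ Eβ.etaDd W →
      Mα.IsStandardSetOfValues hCα εα Sα Eα.etaDd (δ.symm '' W)

/-- **COMPOSITION (PROVED): r6 (forward) ⇒ the typed Thm 1.10 (ii)** (`Thm110ii` = «∃ δ induced by γ
preserving the standard sets of values»). [cite: MochizukiEtTh2009, Thm 1.10 (ii) p.30] -/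
theorem thm110ii_of_valuesForward {H : Thm110Hypothesis εα εβ hCα hCβ Eα Eβ γ}
    {Sα : Mα.StandardData Eα.toKummerData} {Sβ : Mβ.StandardData Eβ.toKummerData}
    {δ : (↥Mα.Kdd)ˣ ≃* (↥Mβ.Kdd)ˣ} (h : Thm110ValuesForward H Sα Sβ δ) : Thm110ii H Sα Sβ :=
  ⟨δ, h.1, h.2⟩

/-- **Row T110.i.r7 — what «(i) follows formally from (ii)» uses about `δ`**: the isomorphism
`K̈_α^× ⥲ K̈_β^×` induced by γ preserves the units `O^×_{K̈}`, the ORDER by `p`-adic absolute value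
(«the unique value ∈ O^×_K … of maximal order»), and `±1` (⇐ [AbsAnab] Prop 1.2.1 (ii)(iii)(v): an
isomorphism of absolute Galois groups of MLFs preserves the images of `O^×`, the valuation and the
torsion — layer L4 named facts `galoisMLF_iso_inertia` / `galoisMLF_iso_unitImage` / `galoisMLF_iso_degrees`,
through the `G_K`-isomorphism underlying γ).  Intermediate statement; not asserted.
[cite: MochizukiEtTh2009, Thm 1.10 (i) p.29] -/
def Thm110DeltaCompat (δ : (↥Mα.Kdd)ˣ ≃* (↥Mβ.Kdd)ˣ) : Prop :=
  (∀ u : (↥Mα.Kdd)ˣ, u ∈ Mα.toThetaSetting.unitsOKdd ↔ δ u ∈ Mβ.toThetaSetting.unitsOKdd) ∧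
  (∀ v w : (↥Mα.Kdd)ˣ,
    ‖((δ v : Mβ.Kdd) : PadicAlgCl p)‖ ≤ ‖((δ w : Mβ.Kdd) : PadicAlgCl p)‖ ↔
      ‖((v : Mα.Kdd) : PadicAlgCl p)‖ ≤ ‖((w : Mα.Kdd) : PadicAlgCl p)‖) ∧
  ∀ v : (↥Mα.Kdd)ˣ,
    (((v : Mα.Kdd) : PadicAlgCl p) = 1 ∨ ((v : Mα.Kdd) : PadicAlgCl p) = -1) ↔
      (((δ v : Mβ.Kdd) : PadicAlgCl p) = 1 ∨ ((δ v : Mβ.Kdd) : PadicAlgCl p) = -1)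

/-- **(i) from (ii), one direction (PROVED, formal)**: if `δ` carries the standard sets of values of α
to standard sets of values of β and is compatible with units / absolute values / `±1`, then standard type
passes from `η̈^{Θ,Z}_α` to `η̈^{Θ,Z}_β`. [cite: MochizukiEtTh2009, Thm 1.10 (i) p.29] -/
theorem isOfStandardType_transfer {Sα : Mα.StandardData Eα.toKummerData}
    {Sβ : Mβ.StandardData Eβ.toKummerData} {δ : (↥Mα.Kdd)ˣ ≃* (↥Mβ.Kdd)ˣ}
    (hV : ∀ V, Mα.IsStandardSetOfValues hCα εα Sα Eα.etaDd V →
      Mβ.IsStandardSetOfValues hCβ εβ Sβ Eβ.etaDd (δ '' V))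
    (hδ : Thm110DeltaCompat (Mα := Mα) (Mβ := Mβ) δ)
    (h : Mα.IsOfStandardType hCα εα Sα Eα.etaDd) : Mβ.IsOfStandardType hCβ εβ Sβ Eβ.etaDd := by
  obtain ⟨V, hVstd, v, hvV, hmin, hunit, hpm⟩ := h
  obtain ⟨hU, hord, hone⟩ := hδ
  refine ⟨δ '' V, hV V hVstd, δ v, ⟨v, hvV, rfl⟩, ?_, (hU v).mp hunit, (hone v).mp hpm⟩
  rintro _ ⟨w, hwV, rfl⟩
  exact (hord v w).mpr (hmin w hwV)

/-- Compatibility of `δ` transfers to `δ⁻¹` (bookkeeping). [cite: MochizukiEtTh2009, Thm 1.10 (i) p.29] -/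
theorem Thm110DeltaCompat.symm {δ : (↥Mα.Kdd)ˣ ≃* (↥Mβ.Kdd)ˣ}
    (hδ : Thm110DeltaCompat (Mα := Mα) (Mβ := Mβ) δ) :
    Thm110DeltaCompat (Mα := Mβ) (Mβ := Mα) δ.symm := by
  obtain ⟨hU, hord, hone⟩ := hδ
  refine ⟨fun u => ?_, fun v w => ?_, fun v => ?_⟩
  · simpa using (hU (δ.symm u)).symm
  · simpa using (hord (δ.symm v) (δ.symm w)).symm
  · simpa using (hone (δ.symm v)).symm

/-- **COMPOSITION (PROVED): r6 (both directions) ∧ r7 ⇒ the typed Thm 1.10 (i)** (`Thm110i` = standard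
type of α ↔ standard type of β) — «assertion (i) follows formally from assertion (ii)».
[cite: MochizukiEtTh2009, Thm 1.10 (i) p.29] -/
theorem thm110i_of_values_of_deltaCompat {H : Thm110Hypothesis εα εβ hCα hCβ Eα Eβ γ}
    {Sα : Mα.StandardData Eα.toKummerData} {Sβ : Mβ.StandardData Eβ.toKummerData}
    {δ : (↥Mα.Kdd)ˣ ≃* (↥Mβ.Kdd)ˣ} (hf : Thm110ValuesForward H Sα Sβ δ)
    (hb : Thm110ValuesBackward H Sα Sβ δ) (hδ : Thm110DeltaCompat (Mα := Mα) (Mβ := Mβ) δ) :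
    Thm110i H Sα Sβ :=
  ⟨isOfStandardType_transfer hf.2 hδ, fun h => by
    have h' := isOfStandardType_transfer (Mα := Mβ) (Mβ := Mα) (δ := δ.symm) hb.2 hδ.symm h
    exact h'⟩

/-! ### Row T110.i.r8: the two uses of «the series representation of Proposition 1.4» -/

variable {M : MuTwoSetting p}

/-- **Row T110.i.r8 (b₁)**: «the UNIQUE value … of maximal order» — within a standard set of values, the
`p`-adic absolute values are pairwise distinct (print: the values at τ along the orbit `η̈^{Θ,Z}` are the
`ξ_j · (√−1)`-power multiples `q^{−j²/2}…` of the series representation, Prop 1.4 (ii)(iii), of pairwise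
distinct order).  No carrier in the §1 interface (`StandardData.tau`, `evalAt` are free data); intermediate
statement, not asserted. [cite: MochizukiEtTh2009, Def 1.9 (ii) p.29] -/
def StandardValuesNormInjective (hC : M.toThetaSetting.Compat) (εZ : M.GtpC)
    {E : M.toThetaSetting.KummerData} (S : M.StandardData E)
    (x : M.toThetaSetting.H1 M.toThetaSetting.GtpYdd) : Prop :=
  ∀ V, M.IsStandardSetOfValues hC εZ S x V →
    Set.InjOn (fun v : (↥M.Kdd)ˣ => ‖((v : M.Kdd) : PadicAlgCl p)‖) V

/-- **Row T110.i.r8 (b₂)**: the values at `τ⁻¹` versus the values at `τ` — «the 4-torsion point τ⁻¹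
determined by −√−1 admits a similar description» (Def 1.9) with `Θ̈(−Ü) = −Θ̈(Ü)` (Prop 1.4 (ii)): the
standard set at `τ⁻¹` is the set of NEGATIVES of the standard set at `τ` (as elements of `K̈^× ⊆ ℚ̄_p^×`).
No carrier in the interface; intermediate statement, not asserted.
[cite: MochizukiEtTh2009, Prop 1.4 (ii) p.20] -/
def StandardValuesInvSymm (hC : M.toThetaSetting.Compat) (εZ : M.GtpC)
    {E : M.toThetaSetting.KummerData} (S : M.StandardData E)
    (x : M.toThetaSetting.H1 M.toThetaSetting.GtpYdd) : Prop :=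
  ∀ v : (↥M.Kdd)ˣ, v ∈ MuTwoSetting.valuesAt hC εZ x S.tauInv ↔
    ∃ w ∈ MuTwoSetting.valuesAt hC εZ x S.tau, ((v : M.Kdd) : PadicAlgCl p) = -((w : M.Kdd) : PadicAlgCl p)


/-! ### v2 (rows T110.i.r8, honest shape agreed with the §1 owner abc-iut-L2-t1, 2026-08-26): the two
interface-invisible inputs behind «determines this collection of classes up to multiplication by ±1» -/

/-- **Row T110.i.r8 (V2′) — Π^tp_Ẋ-EQUIVARIANCE OF THE UNIT KUMMER CLASSES**: for every `σ` of the
orbit group (`inclX σ ∈ Π^tp_Ẋ`) and every `u ∈ O^×_{K̈}`, conjugation by `σ` fixes the inflated Kummer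
class `infl κ(u)` on `Π^tp_Ÿ`.  Printed reason: `K = K̈` (Def 1.7 (I)) and `Π^tp_X` acts on
`H¹(G_K, Δ_Θ) ⊆ H¹(Π^tp_Ċ, Δ_Θ)` through `G_K`, i.e. innerly (Thm 1.10 (ii): «we regard `K^× ⊆ (K^×)^∧` …
`= H¹(G_K, (Δ_Θ))`»).  The §1 interface proves it only for `σ ∈ Π^tp_Y`
(`KummerData.conj_inflTheta_kumYdd_eq_self`); for `σ ∉ Π^tp_Y` it records only `conj σ κ(u) ∈ F̈²`.
Intermediate statement; not asserted. [cite: MochizukiEtTh2009, Thm 1.10 (ii) p.30] -/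
def Thm110UnitClassEquivariance (hC : M.toThetaSetting.Compat) (εZ : M.GtpC)
    (E : M.toThetaSetting.KummerData) : Prop :=
  ∀ σ : M.PiTemp, M.inclX σ ∈ M.dotX εZ → ∀ u ∈ M.toThetaSetting.unitsOKdd,
    haveI := hC.GtpYdd_normal
    ContH1.conj M.toTheta M.toThetaSetting.DeltaTheta σ
        (M.toThetaSetting.inflTheta M.toThetaSetting.GtpYdd (E.kumYdd (E.toKddHat u))) =
      M.toThetaSetting.inflTheta M.toThetaSetting.GtpYdd (E.kumYdd (E.toKddHat u))

/-- **Row T110.i.r8 (V1′) — THE VALUE FORMULA AT `τ`** («the series representation of Proposition 1.4»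
at the value level, [EtTh] Prop 1.4 (ii) p.248: `Θ̈(q̈^{a}·√−1) = q̈^{−a²}·Θ̈(√−1)`, the factors
`(−1)^a·(√−1)^{−2a}` cancelling): the set of values at `τ` of the orbit `η̈^{Θ,Z}` of `x` is
`{q̈^{−a²} · v₀ | a ∈ ℤ}`, `v₀` the value of `x` itself at `τ`.  Interface-invisible (`StandardData.tau` is
pinned only by its coordinate and `NonCuspidalPoint.evalAt` is free data: nothing ties `log(Ü)|_τ` to
`Ü(τ) = √−1`); intermediate statement, not asserted.  The companion formula at `τ⁻¹` is
`StandardValuesInvSymm`. [cite: MochizukiEtTh2009, Prop 1.4 (ii) p.20] -/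
def StandardValuesFormula (hC : M.toThetaSetting.Compat) (εZ : M.GtpC)
    {E : M.toThetaSetting.KummerData} (S : M.StandardData E)
    (x : M.toThetaSetting.H1 M.toThetaSetting.GtpYdd) : Prop :=
  ∃ v₀ : (↥M.Kdd)ˣ,
    S.tau.evalAt (ContH1.res M.toTheta M.toThetaSetting.DeltaTheta S.tau.Dpt_le x) = E.toKddHat v₀ ∧
    ∀ v : (↥M.Kdd)ˣ, v ∈ MuTwoSetting.valuesAt hC εZ x S.tau ↔
      ∃ a : ℤ, ((v : M.Kdd) : PadicAlgCl p) =
        M.toThetaSetting.qdd ^ (-(a * a)) * ((v₀ : M.Kdd) : PadicAlgCl p)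

/-! ### v3 (row T110.i.r8, finding F-L2t6g4-1 of abc-iut-L2-t6): the value formula WITH the branch
sign of `ε_Z` -/

/-- **Row T110.i.r8 (V1″) — THE VALUE FORMULA AT `τ`, SIGNED** (repair of the sign-blind V1′, finding
F-L2t6g4-1): of the two admissible choices `ε_Z ∈ Gal(Ẍ/X) = {1, [−1], [q̈], [−q̈]}`,
`ε_Z ≠ 1, ε_μ = [−1]` (Def 1.7, p.253 «for some choice of ε_Z»), the orbit group `Π^tp_Ẋ/Π^tp_Ÿ ≅ ℤ`
acts on the coordinate by `Ü ↦ s·q̈·Ü` with `s = +1` (`ε_Z = [q̈]`) or `s = −1` (`ε_Z = [−q̈]`), so by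
[EtTh] Prop 1.4 (ii) (`Θ̈(−Ü) = −Θ̈(Ü)`, `Θ̈(q̈^a·√−1) = q̈^(−a²)·Θ̈(√−1)` at the value level) the set of
values at `τ` of the orbit `η̈^{Θ,Z}` of `x` is `{s^a · q̈^(−a²) · v₀ | a ∈ ℤ}`, `v₀` the value of `x`
itself at `τ`.  Interface-invisible for the same reason as V1′ (`NonCuspidalPoint.evalAt` is free
data; the naturality of evaluation along the orbit group has no carrier); intermediate statement, not
asserted.  Since `‖s^a‖ = 1`, the «unique value of maximal order» is still the `a = 0` value `v₀`
(Def 1.9 (ii)), which is all the uniqueness clause of Thm 1.10 (i) uses.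
[cite: MochizukiEtTh2009, Prop 1.4 (ii) p.20] -/
def StandardValuesFormulaSigned (hC : M.toThetaSetting.Compat) (εZ : M.GtpC)
    {E : M.toThetaSetting.KummerData} (S : M.StandardData E)
    (x : M.toThetaSetting.H1 M.toThetaSetting.GtpYdd) : Prop :=
  ∃ v₀ : (↥M.Kdd)ˣ, ∃ s : PadicAlgCl p, (s = 1 ∨ s = -1) ∧
    S.tau.evalAt (ContH1.res M.toTheta M.toThetaSetting.DeltaTheta S.tau.Dpt_le x) = E.toKddHat v₀ ∧
    ∀ v : (↥M.Kdd)ˣ, v ∈ MuTwoSetting.valuesAt hC εZ x S.tau ↔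
      ∃ a : ℤ, ((v : M.Kdd) : PadicAlgCl p) =
        s ^ a * M.toThetaSetting.qdd ^ (-(a * a)) * ((v₀ : M.Kdd) : PadicAlgCl p)

/-- V1′ is the `s = 1` (`ε_Z = [q̈]`) case of V1″. [cite: MochizukiEtTh2009, Prop 1.4 (ii) p.20] -/
theorem standardValuesFormulaSigned_of_formula {hC : M.toThetaSetting.Compat} {εZ : M.GtpC}
    {E : M.toThetaSetting.KummerData} {S : M.StandardData E}
    {x : M.toThetaSetting.H1 M.toThetaSetting.GtpYdd} (h : StandardValuesFormula hC εZ S x) :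
    StandardValuesFormulaSigned hC εZ S x := by
  obtain ⟨v₀, hv₀, hV⟩ := h
  refine ⟨v₀, 1, Or.inl rfl, hv₀, fun v => ?_⟩
  simp only [one_zpow, one_mul]
  exact hV v

end Thm110Sub

end Literature.AnabelianGeometry.EtaleTheta

end
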